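import Summits.QuantumFields.BalabanUV.Beta.EriceRemainderEnclosureHistoryAutonomyComparisonDualChainCriterion
import Summits.QuantumFields.BalabanUV.Beta.EriceRemainderEnclosureHistoryAutonomyComparisonCubeBudgetedCriterion

/-!
# EriceRemainderEnclosureHistoryAutonomyComparisonCubeDualChainCriterion — (E70h) (E65f)'s DUAL-CHAIN CRITERION WITH THE CUBE BUDGET HANDED DOWN:
# `B = b + Σ_{k<K} L_k·u_k` (ANY finite age set `A`) compares at any size under every isotone excess as soon as the minimal dual chain of (E65e) closes
# for every load vector obeying the profile bound, the WINDOW budget AND (E70g)'s trajectory-free CUBE budget (pin share `ε`, level ratios `ρ` with the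
# cube transport on the old side) — the socket the successor's chain∕DP route (C″-cube) plugs into

Cell `pub-balaban`, β-function sub-cell, BINDER row D4 «RemainderConst leaves for Bałaban's split» (`HOME/BINDER-OWNERS.md`; owner lineage `b2b-balaban-beta-an4`;
this file by co-owner #2 lineage `b2b-balaban-beta-d4-p2`, generation 60), β-FLOW TEAM duty (1), FREEZE (0) honoured (def-free; (E70g)'s
`le_of_isotone_excess_cube_budgeted_certificate`, (E65e)'s `certificate_of_dual_chain`, (E65d)'s `load_le_sqrt_two_div_two_of_budget` BY NAME; nothing restated).

HONEST FRAMING (page 1, verbatim and binding).  *"Discharging BetaPertH makes Bałaban's UV stability UNCONDITIONAL — a real constructive-QFT result; it is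
NOT the continuum limit and NOT the Clay problem."*  THIS FILE DISCHARGES NOTHING OF THE KIND.  Elementary real analysis about ABSTRACT affine functionals on a
box ]0,γ]^ℕ with displayed floors, profiles and signs — hypotheses of a census, not facts; the form, signs, ages and moments of Bałaban's (1.22) limit functional
are NOT PRINTED ([I] p. 298; GAPS G-t4-U2-1∕-2) and NOT asserted.  Row D4 class UNCHANGED (critical-path width 0; instance 0∕1; D4 DISCHARGE NO DATE).  HONEST
DEPENDENCY: continuum YM on T⁴ ⇐ BetaPertH ∧ nine spine estimates (0/9 proved); BetaPertH ⇐ (D1) ∧ (D4) ∧ CAP+tail; G-an2-4 gates asym, D1 and NE2/3/4.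

THE POINT (census sense (α); the COMPARISON column, conjecture (E58′), programme (C″)).  (E66)–(E69) close the dual chain from the window budget at each age's
own scale; the relaxations diverge at ratio 2 because the window budget admits uniform tower loads (`0.098`–`0.12`) next to the λ-chain threshold `4∕31`.  With
the cube budget of (E70b)∕(E70g) also in the hypothesis — old ages press on young scales with `ρ_k ≳ (k∕j)^{2∕3}` — the admissible uniform loads drop to
`0.065` (R = 2), `0.101` (R = 3), `0.126` (R = 4); causally the cube budget acts as a SHADOW SLACK `Q′ = r^{−1∕3}·min(Q − c·x, f(U + W·x))` (README
`HOME/b2b-balaban-beta-d4-p2/g60/e70/README.md`).  This file is the plumbing: the chain hypothesis now receives the cube data.  NOT CLAIMED: that the chain closes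
for every profile; anything printed.

WHAT IS PROVED ([folklore]; 0 `def`, 0 sorry).  **`le_of_isotone_excess_of_cube_budgeted_dual_chain`** (END: (E70g) ∘ (E65e)).
-/
noncomputable section
open Finset Set

namespace Summit.QuantumFields.BalabanUV.Beta.EriceRemainderEnclosureHistoryAutonomyComparisonCubeDualChainCriterion

open Literature.MathematicalPhysics.QuantumFieldTheory.Balaban1983to89
open Literature.MathematicalPhysics.QuantumFieldTheory.Balaban1983to89.T4BetaStationary
open Literature.MathematicalPhysics.QuantumFieldTheory.Balaban1983to89.T4BetaFlowWellPosed
open Summit.QuantumFields.BalabanUV.Beta.EriceRemainderEnclosureHistoryAutonomyComparisonGreedyDualChain (certificate_of_dual_chain)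
open Summit.QuantumFields.BalabanUV.Beta.EriceRemainderEnclosureHistoryAutonomyComparisonChainCriterion (load_le_sqrt_two_div_two_of_budget)
open Summit.QuantumFields.BalabanUV.Beta.EriceRemainderEnclosureHistoryAutonomyComparisonCubeBudgetedCriterion (le_of_isotone_excess_cube_budgeted_certificate)

variable {B' : (ℕ → ℝ) → ℝ} {M' γ b : ℝ} {L : ℕ → ℝ} {K : ℕ} {A : Finset ℕ} {h h' : ℕ → ℝ}

/-- **COMPARISON AT ANY SIZE WHEN THE WINDOW + CUBE BUDGETS CLOSE THE DUAL CHAIN.**  As (E65f) `le_of_isotone_excess_of_budgeted_dual_chain`, with the chain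
hypothesis ALSO receiving, at every scale `j ≥ 1`, (E70g)'s cube data: `ε ∈ [0,1]`, `ρ_k ≥ 0` (`ρ_k ≥ 1`, `ρ_k³ = σ_k²`, `j·σ_k + (k−j)·ε ≥ k` for `k > j`;
`j·ρ_k ≥ k` for `k ≤ j`) with `ε + Σ_{k∈A} 2x_k(S_{k,j}∕k)ρ_k ≤ 1`. [folklore] -/
theorem le_of_isotone_excess_of_cube_budgeted_dual_chain {p : ℝ} {pred : ℕ → ℕ} {m₀ : ℕ} (hL : ∀ k, 0 ≤ L k) (hb : 0 < b) (hAK : A ⊆ range K)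
    (hA1 : ∀ k ∈ A, 1 ≤ k) (hsupp : ∀ k ∈ range K, k ∉ A → k ≠ 0 → L k = 0) (hm₀ : m₀ ∈ A) (hmin : ∀ k ∈ A, m₀ ≤ k)
    (hpred : ∀ k ∈ A, k ≠ m₀ → pred k ∈ A ∧ pred k < k ∧ ∀ k'' ∈ A, k'' < k → k'' ≤ pred k)
    (hchain : ∀ x : ℕ → ℝ, (∀ k ∈ A, 0 ≤ x k) →
      (∀ k ∈ A, x k ≤ L k / (2 * ∑ k' ∈ range K, L k' * Real.sqrt ((k : ℝ) / ((k : ℝ) + k')))) →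
      (∀ j : ℕ, 1 ≤ j → ∑ k ∈ A, x k *
        (if k ≤ j then (∑ l ∈ range j, Real.sqrt ((k : ℝ) / ((k : ℝ) + l + 1))) / j
          else (∑ l ∈ range j, Real.sqrt ((k : ℝ) / ((k : ℝ) + l + 1))) / k) ≤ 1 / 2) →
      (∀ j : ℕ, 1 ≤ j → ∃ ε : ℝ, ∃ ρ σ : ℕ → ℝ, 0 ≤ ε ∧ ε ≤ 1 ∧ (∀ k, 0 ≤ ρ k) ∧ (∀ k, j < k → 1 ≤ ρ k) ∧ (∀ k, ρ k ^ 3 = σ k ^ 2) ∧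
        (∀ k, k ≤ j → (k : ℝ) ≤ j * ρ k) ∧ (∀ k, j < k → (k : ℝ) ≤ j * σ k + ((k : ℝ) - j) * ε) ∧
        ε + ∑ k ∈ A, 2 * x k * ((∑ l ∈ range j, Real.sqrt ((k : ℝ) / ((k : ℝ) + l + 1))) / k) * ρ k ≤ 1) →
      ∃ μ lam : ℕ → ℝ, (∀ k ∈ A, 0 ≤ μ k) ∧ (∀ k ∈ A, 0 ≤ lam k) ∧
        3 / 4 * x m₀ ≤ μ m₀ * (1 - 3 / 4 * x m₀) ∧ x m₀ ≤ lam m₀ * (1 - 3 / 4 * x m₀) ∧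
        (∀ k ∈ A, k ≠ m₀ →
          x k * (min (4 * (pred k : ℝ) * k / ((k : ℝ) + pred k) ^ 2 * μ (pred k)) (2 * lam (pred k) * ((pred k : ℝ) / k)) + 3 / 4) < 1) ∧
        (∀ k ∈ A, k ≠ m₀ →
          min (4 * (pred k : ℝ) * k / ((k : ℝ) + pred k) ^ 2 * μ (pred k)) (2 * lam (pred k) * ((pred k : ℝ) / k)) * (1 + x k) + 3 / 4 * x k ≤
            μ k * (1 - x k * (3 / 4 + min (4 * (pred k : ℝ) * k / ((k : ℝ) + pred k) ^ 2 * μ (pred k)) (2 * lam (pred k) * ((pred k : ℝ) / k))))) ∧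
        (∀ k ∈ A, k ≠ m₀ →
          lam (pred k) * ((pred k : ℝ) / k) * (1 + x k / 4) +
              x k * (1 + min (4 * (pred k : ℝ) * k / ((k : ℝ) + pred k) ^ 2 * μ (pred k)) (2 * lam (pred k) * ((pred k : ℝ) / k))) ≤
            lam k * (1 - x k * (3 / 4 + min (4 * (pred k : ℝ) * k / ((k : ℝ) + pred k) ^ 2 * μ (pred k)) (2 * lam (pred k) * ((pred k : ℝ) / k))))))
    (hB' : ∀ u u' : ℕ → ℝ, SeqBox γ u → SeqBox γ u' → ∀ D : ℝ, (∀ j, |u j - u' j| ≤ D) → |B' u - B' u'| ≤ M' * D) (hM' : 0 ≤ M')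
    (hexc : ∀ u, SeqBox γ u → (fun u : ℕ → ℝ => b + ∑ k ∈ range K, L k * u k) u ≤ B' u)
    (hDmono : ∀ u v : ℕ → ℝ, SeqBox γ u → SeqBox γ v → (∀ j, u j ≤ v j) →
      B' u - (fun u : ℕ → ℝ => b + ∑ k ∈ range K, L k * u k) u ≤ B' v - (fun u : ℕ → ℝ => b + ∑ k ∈ range K, L k * u k) v)
    (hp : 0 < p) (hpγ : p ≤ γ) (hh : SeqBox γ h) (hf : MemFlow (fun u : ℕ → ℝ => b + ∑ k ∈ range K, L k * u k) p h)
    (hh' : SeqBox γ h') (hf' : MemFlow B' p h') (j : ℕ) : h' j ≤ h j := by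
  refine le_of_isotone_excess_cube_budgeted_certificate hL hb hAK hA1 hsupp (fun x hx hP hbud hcube => ?_) hB' hM' hexc hDmono hp hpγ hh hf hh' hf' j
  obtain ⟨μ, lam, hμ, hlam, hμ₀, hlam₀, hcond, hrecμ, hrecL⟩ := hchain x hx hP hbud hcube
  have hx₀ : 3 / 4 * x m₀ < 1 := by
    have h1 := load_le_sqrt_two_div_two_of_budget hx hm₀ (hA1 m₀ hm₀) (hbud m₀ (hA1 m₀ hm₀))
    have h2 : Real.sqrt 2 < 2 := by
      have h3 : Real.sqrt 2 < Real.sqrt (2 ^ 2) := Real.sqrt_lt_sqrt (by norm_num) (by norm_num)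
      rwa [Real.sqrt_sq (by norm_num : (0 : ℝ) ≤ 2)] at h3
    linarith
  exact certificate_of_dual_chain hA1 hx hm₀ hmin hpred hμ hlam hx₀ hμ₀ hlam₀ hcond hrecμ hrecL

end Summit.QuantumFields.BalabanUV.Beta.EriceRemainderEnclosureHistoryAutonomyComparisonCubeDualChainCriterion

end
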